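import Literature.NumberTheory.Automorphic.MeyerDifferenceRepresentation
import Literature.NumberTheory.Automorphic.IdeleClassGroupProofs
import Literature.NumberTheory.GaloisRepresentations.HeckeCharacterProofs
import HarnessLib

/-!
# Meyer's global difference representation — proofs, `K = ℚ`: `C_ℚ = ℝ_{>0} · 𝒪̂ˣ`

Topic `NumberTheory/Automorphic`; namespace `Literature.NumberTheory.Automorphic.Meyer`. Sibling
PROOF file of `MeyerDifferenceRepresentation` (Step B of the plan for
`Meyer.spectralRealisation_rat` [Meyer2005, Thm. 5.11], the `K = ℚ` specifics). Meyer
[Meyer2005, §1 p. 3]: "the group `C_ℚ` is isomorphic to the direct product `∏_p ℤ_pˣ × ℝ`"; in the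
tree this is `𝕀_ℚ = ℚˣ · (ℝ_{>0} × ∏_p ℤ_pˣ)` (Neukirch VI (1.10), `Rat.unitIdele` of
`GaloisRepresentations/HeckeCharacterProofs`). We derive the form consumed by the spectral
analysis of `π₋` at unramified quasi-characters:

* `ideleNorm_unitIdele` — `|u(x)| = u(x)_∞` for the unit part `u(x)` of an idele of `ℚ`;
* `fst_unitIdele_eq_realToInfiniteAdele` — `u(x)_∞ = z(u(x)_∞)` is a diagonal positive real scalar;
* `mk_unitIdele_eq` — `[u(x)] = [z(u(x)_∞)] · finiteUnitClass (u(x)_f)`;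
* **`exists_eq_mk_posRealIdele_mul`** — every idele class `c ∈ C_ℚ` is
  `c = [z(|c|)] · finiteUnitClass u` with `u ∈ 𝒪̂ˣ` (`z = posRealIdele ℚ`, `|c|` the norm);
* `norm_mk_posRealIdele`, `classNorm_mk_posRealIdele` — `|[z(t)]| = t`;
* **`apply_eq_of_unramified`** — a function on `C_ℚ` invariant under `𝒪̂ˣ` is a function of the
  norm: `f c = f [z(|c|)]`; `eq_of_unramified_of_forall` — two such functions agreeing on the
  classes `[z(t)]`, `t > 0`, are equal.

Everything is proved; no definitions, no named facts.

## References

* R. Meyer, *On a representation of the idele class group related to primes and zeros of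
  L-functions*, Duke Math. J. 127 (2005) = arXiv:math/0311468, §1 p. 3, §5.1 [Meyer2005].
* J. Neukirch, *Algebraic Number Theory* (1999), Ch. VI §1, Prop. (1.10) [NeukirchANT1999].
-/

noncomputable section

open NumberField NumberField.InfinitePlace IsDedekindDomain
open scoped NNReal

namespace Literature.NumberTheory.Automorphic.Meyer

open Literature.NumberTheory.GaloisRepresentations

section Rat

/-- The infinite component of an idele of `ℚ` has absolute value `|x_∞|` at the infinite place
(the real embedding of `ℚ_∞` is an isometry). [folklore] -/
theorem norm_fst_apply_eq_abs_infReal (x : ideleGroup ℚ) (w : InfinitePlace ℚ) :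
    ‖(x : AdeleRing (𝓞 ℚ) ℚ).1 w‖ = |Rat.infReal x| := by
  have hw : w = Rat.infinitePlace := Subsingleton.elim _ _
  subst hw
  rw [Rat.infReal_apply, ← Real.norm_eq_abs]
  change ‖(x : AdeleRing (𝓞 ℚ) ℚ).1 Rat.infinitePlace‖ =
    ‖Completion.extensionEmbeddingOfIsReal (Rat.isReal_infinitePlace' Rat.infinitePlace)
      ((x : AdeleRing (𝓞 ℚ) ℚ).1 Rat.infinitePlace)‖
  exact ((AddMonoidHomClass.isometry_iff_norm _).1
    (Completion.isometry_extensionEmbeddingOfIsReal (Rat.isReal_infinitePlace' Rat.infinitePlace)) _).symm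

/-- A local element of valuation `1` has norm `1`. [folklore] -/
theorem nnnorm_eq_one_of_valued_eq_one {v : HeightOneSpectrum (𝓞 ℚ)} {a : v.adicCompletion ℚ}
    (ha : Valued.v a = 1) : ‖a‖₊ = 1 := by
  apply le_antisymm
  · rw [← NNReal.coe_le_coe, coe_nnnorm, NNReal.coe_one]
    exact Valued.toNormedField.norm_le_one_iff.mpr ha.le
  · rw [← NNReal.coe_le_coe, coe_nnnorm, NNReal.coe_one]
    exact Valued.toNormedField.one_le_norm_iff.mpr ha.ge

/-- **`|u(x)|_𝔸 = u(x)_∞`** for the unit part `u(x) ∈ ℝ_{>0} × ∏_p ℤ_pˣ` of an idele of `ℚ`.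
[cite: NeukirchANT1999, Ch. VI §1 (1.10)] -/
theorem ideleNorm_unitIdele (x : ideleGroup ℚ) :
    (IdeleClassGroup.ideleNorm ℚ (Rat.unitIdele x) : ℝ) = Rat.infReal (Rat.unitIdele x) := by
  rw [ideleNorm_apply, NNReal.coe_mul, NNReal.coe_prod]
  have hfin : ∏ᶠ v : HeightOneSpectrum (𝓞 ℚ), ‖((Rat.unitIdele x : ideleGroup ℚ) : AdeleRing (𝓞 ℚ) ℚ).2 v‖₊ = 1 :=
    finprod_eq_one_of_forall_eq_one fun v => nnnorm_eq_one_of_valued_eq_one (Rat.valued_unitIdele v x)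
  rw [hfin, NNReal.coe_one, mul_one, Finset.univ_unique, Finset.prod_singleton]
  have hmult : (default : InfinitePlace ℚ).mult = 1 := by
    rw [InfinitePlace.mult, if_pos (Rat.isReal_infinitePlace' _)]
  rw [hmult, pow_one, coe_nnnorm, norm_fst_apply_eq_abs_infReal,
    abs_of_pos (Rat.infReal_unitIdele_pos x)]

/-- **The infinite component of `u(x)` is the diagonal real scalar `z(u(x)_∞)`**
(`realToInfiniteAdele`). [folklore] -/
theorem fst_unitIdele_eq_realToInfiniteAdele (x : ideleGroup ℚ) :
    ((Rat.unitIdele x : ideleGroup ℚ) : AdeleRing (𝓞 ℚ) ℚ).1 = realToInfiniteAdele ℚ (Rat.infReal (Rat.unitIdele x)) := by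
  funext w
  have hw : w = Rat.infinitePlace := Subsingleton.elim _ _
  subst hw
  apply (Rat.completionRealEquiv Rat.infinitePlace).injective
  rw [← Rat.infReal_apply]
  -- `completionRealEquiv (z(t))_∞ = t`
  apply Complex.ofReal_injective
  change _ = ((Completion.extensionEmbeddingOfIsReal (Rat.isReal_infinitePlace' Rat.infinitePlace)
    (realToInfiniteAdele ℚ (Rat.infReal (Rat.unitIdele x)) Rat.infinitePlace) : ℝ) : ℂ)
  rw [Completion.extensionEmbeddingOfIsReal_apply, extensionEmbedding_realToInfiniteAdele_apply]

/-- The finite part of the unit idele `u(x)` is an integral unit: `u(x)_p ∈ ℤ_pˣ`. [folklore] -/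
theorem finPart_unitIdele_mem (x : ideleGroup ℚ) :
    Units.map (RingHom.snd (InfiniteAdeleRing ℚ) (FiniteAdeleRing (𝓞 ℚ) ℚ)).toMonoidHom (Rat.unitIdele x) ∈
      integralFiniteUnits ℚ := by
  intro v
  refine ⟨?_, ?_⟩
  · change ((Rat.unitIdele x : ideleGroup ℚ) : AdeleRing (𝓞 ℚ) ℚ).2 v ∈ v.adicCompletionIntegers ℚ
    rw [HeightOneSpectrum.mem_adicCompletionIntegers]
    exact (Rat.valued_unitIdele v x).le
  · set u := Units.map (RingHom.snd (InfiniteAdeleRing ℚ) (FiniteAdeleRing (𝓞 ℚ) ℚ)).toMonoidHom (Rat.unitIdele x) with hu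
    have hu1 : Valued.v ((u : FiniteAdeleRing (𝓞 ℚ) ℚ) v) = 1 := Rat.valued_unitIdele v x
    have h1 : Valued.v (((u⁻¹ : (FiniteAdeleRing (𝓞 ℚ) ℚ)ˣ) : FiniteAdeleRing (𝓞 ℚ) ℚ) v) *
        Valued.v ((u : FiniteAdeleRing (𝓞 ℚ) ℚ) v) = 1 := by
      rw [← Valuation.map_mul, ← FiniteAdeleRing.mul_apply', ← Units.val_mul, inv_mul_cancel, Units.val_one,
        show ((1 : FiniteAdeleRing (𝓞 ℚ) ℚ) v) = 1 from rfl, Valuation.map_one]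
    rw [hu1, mul_one] at h1
    rw [HeightOneSpectrum.mem_adicCompletionIntegers]
    exact h1.le

/-- The class of the unit part is the class of the idele: `[u(x)] = [x]`. [folklore] -/
theorem mk_unitIdele (x : ideleGroup ℚ) :
    IdeleClassGroup.mk ℚ (Rat.unitIdele x) = IdeleClassGroup.mk ℚ x := by
  rw [Rat.unitIdele_apply, map_mul, map_inv]
  have h : IdeleClassGroup.mk ℚ (GaloisRepresentations.principalIdele ℚ (Rat.ratPart x)) = 1 :=
    (QuotientGroup.eq_one_iff (GaloisRepresentations.principalIdele ℚ (Rat.ratPart x))).mpr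
      (GaloisRepresentations.principalIdele_mem _)
  rw [h, inv_one]
  exact mul_one (IdeleClassGroup.mk ℚ x)

/-- **`[u(x)] = [z(u(x)_∞)] · finiteUnitClass (u(x)_f)`**: the class of the unit idele is the
product of the class of a diagonal positive real scalar and the class of its finite (integral unit)
part (`u(x) = z(u(x)_∞) · (1, u(x)_f)` componentwise). [cite: NeukirchANT1999, Ch. VI §1 (1.10)] -/
theorem mk_unitIdele_eq (x : ideleGroup ℚ) :
    IdeleClassGroup.mk ℚ (Rat.unitIdele x) =
      IdeleClassGroup.mk ℚ (posRealIdele ℚ (Units.mk0 ⟨Rat.infReal (Rat.unitIdele x), (Rat.infReal_unitIdele_pos x).le⟩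
        (by rw [Ne, ← NNReal.coe_eq_zero]; exact (Rat.infReal_unitIdele_pos x).ne'))) *
      finiteUnitClass ℚ
        (Units.map (RingHom.snd (InfiniteAdeleRing ℚ) (FiniteAdeleRing (𝓞 ℚ) ℚ)).toMonoidHom (Rat.unitIdele x)) := by
  set u : (FiniteAdeleRing (𝓞 ℚ) ℚ)ˣ :=
    Units.map (RingHom.snd (InfiniteAdeleRing ℚ) (FiniteAdeleRing (𝓞 ℚ) ℚ)).toMonoidHom (Rat.unitIdele x) with hu
  set j : ideleGroup ℚ := Units.map (MonoidHom.inr (InfiniteAdeleRing ℚ) (FiniteAdeleRing (𝓞 ℚ) ℚ) :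
    FiniteAdeleRing (𝓞 ℚ) ℚ →* AdeleRing (𝓞 ℚ) ℚ) u with hj
  set T : ℝ≥0ˣ := Units.mk0 ⟨Rat.infReal (Rat.unitIdele x), (Rat.infReal_unitIdele_pos x).le⟩
    (by rw [Ne, ← NNReal.coe_eq_zero]; exact (Rat.infReal_unitIdele_pos x).ne') with hT
  have hfu : finiteUnitClass ℚ u = IdeleClassGroup.mk ℚ j := rfl
  have hprod : Rat.unitIdele x = posRealIdele ℚ T * j := by
    refine Units.ext (Prod.ext ?_ ?_)
    · rw [Units.val_mul]
      change ((Rat.unitIdele x : ideleGroup ℚ) : AdeleRing (𝓞 ℚ) ℚ).1 =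
        ((posRealIdele ℚ T : ideleGroup ℚ) : AdeleRing (𝓞 ℚ) ℚ).1 * 1
      rw [mul_one, posRealIdele_fst, fst_unitIdele_eq_realToInfiniteAdele]
      rfl
    · rw [Units.val_mul]
      change ((Rat.unitIdele x : ideleGroup ℚ) : AdeleRing (𝓞 ℚ) ℚ).2 =
        ((posRealIdele ℚ T : ideleGroup ℚ) : AdeleRing (𝓞 ℚ) ℚ).2 *
          ((Rat.unitIdele x : ideleGroup ℚ) : AdeleRing (𝓞 ℚ) ℚ).2
      rw [posRealIdele_snd, one_mul]
  rw [hfu, hprod, map_mul]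

/-- The norm of an idele class is non-zero (as an element of `ℝ≥0`). [folklore] -/
theorem norm_ne_zero' (c : IdeleClassGroup ℚ) : IdeleClassGroup.norm ℚ c ≠ 0 := by
  have h := classNorm_ne_zero c
  rwa [classNorm, NNReal.coe_ne_zero] at h

/-- **`|[z(t)]| = t`**: the norm of the class of the diagonal positive real idele `z(t)` of `ℚ` is `t`
(`|z(t)| = t^{[ℚ:ℚ]}`). [cite: Meyer2005, §1 p. 3] -/
theorem norm_mk_posRealIdele (t : ℝ≥0ˣ) :
    IdeleClassGroup.norm ℚ (IdeleClassGroup.mk ℚ (posRealIdele ℚ t)) = (t : ℝ≥0) := by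
  rw [IdeleClassGroup.mk_apply, IdeleClassGroup.norm_mk, ideleNorm_posRealIdele_holds ℚ t,
    Module.finrank_self, pow_one]

/-- `|[z(t)]| = t` in `ℝ`. [cite: Meyer2005, §1 p. 3] -/
theorem classNorm_mk_posRealIdele (t : ℝ≥0ˣ) :
    classNorm ℚ (IdeleClassGroup.mk ℚ (posRealIdele ℚ t)) = ((t : ℝ≥0) : ℝ) := by
  rw [classNorm, norm_mk_posRealIdele]

/-- **`C_ℚ = ℝ_{>0} · 𝒪̂ˣ`** [Meyer2005, §1 p. 3: "`C_ℚ ≅ ∏_p ℤ_pˣ × ℝ`"]: every idele class of `ℚ`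
is `c = [z(|c|)] · finiteUnitClass u` with `u ∈ 𝒪̂ˣ = ∏_p ℤ_pˣ`. [cite: Meyer2005, §1 p. 3] -/
theorem exists_eq_mk_posRealIdele_mul (c : IdeleClassGroup ℚ) :
    ∃ u ∈ integralFiniteUnits ℚ,
      c = IdeleClassGroup.mk ℚ (posRealIdele ℚ (Units.mk0 (IdeleClassGroup.norm ℚ c) (norm_ne_zero' c))) *
        finiteUnitClass ℚ u := by
  induction c using QuotientGroup.induction_on with
  | H x =>
    refine ⟨Units.map (RingHom.snd (InfiniteAdeleRing ℚ) (FiniteAdeleRing (𝓞 ℚ) ℚ)).toMonoidHom (Rat.unitIdele x),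
      finPart_unitIdele_mem x, ?_⟩
    -- the norm of `[x]` is `u(x)_∞`
    have hnorm : Units.mk0 (IdeleClassGroup.norm ℚ (x : IdeleClassGroup ℚ)) (norm_ne_zero' _) =
        Units.mk0 ⟨Rat.infReal (Rat.unitIdele x), (Rat.infReal_unitIdele_pos x).le⟩
          (by rw [Ne, ← NNReal.coe_eq_zero]; exact (Rat.infReal_unitIdele_pos x).ne') := by
      refine Units.ext (NNReal.eq ?_)
      change (IdeleClassGroup.norm ℚ (x : IdeleClassGroup ℚ) : ℝ) = Rat.infReal (Rat.unitIdele x)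
      rw [← IdeleClassGroup.mk_apply, ← mk_unitIdele, IdeleClassGroup.mk_apply, IdeleClassGroup.norm_mk,
        ideleNorm_unitIdele]
    rw [hnorm]
    calc (x : IdeleClassGroup ℚ) = IdeleClassGroup.mk ℚ (Rat.unitIdele x) := (mk_unitIdele x).symm
      _ = _ := mk_unitIdele_eq x

/-- **Unramified functions on `C_ℚ` are functions of the norm**: if `f` is invariant under
`𝒪̂ˣ` then `f c = f [z(|c|)]`. [cite: Meyer2005, §5.1] -/
theorem apply_eq_of_unramified {E : Type*} {f : IdeleClassGroup ℚ → E}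
    (hf : ∀ u ∈ integralFiniteUnits ℚ, ∀ x, f (x * finiteUnitClass ℚ u) = f x) (c : IdeleClassGroup ℚ) :
    f c = f (IdeleClassGroup.mk ℚ (posRealIdele ℚ (Units.mk0 (IdeleClassGroup.norm ℚ c) (norm_ne_zero' c)))) := by
  obtain ⟨u, hu, hc⟩ := exists_eq_mk_posRealIdele_mul c
  conv_lhs => rw [hc]
  exact hf u hu _

/-- Two `𝒪̂ˣ`-invariant functions on `C_ℚ` which agree on the classes `[z(t)]`, `t > 0`, are equal.
[cite: Meyer2005, §5.1] -/
theorem eq_of_unramified_of_forall {E : Type*} {f g : IdeleClassGroup ℚ → E}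
    (hf : ∀ u ∈ integralFiniteUnits ℚ, ∀ x, f (x * finiteUnitClass ℚ u) = f x)
    (hg : ∀ u ∈ integralFiniteUnits ℚ, ∀ x, g (x * finiteUnitClass ℚ u) = g x)
    (h : ∀ t : ℝ≥0ˣ, f (IdeleClassGroup.mk ℚ (posRealIdele ℚ t)) = g (IdeleClassGroup.mk ℚ (posRealIdele ℚ t))) :
    f = g := by
  funext c
  rw [apply_eq_of_unramified hf c, apply_eq_of_unramified hg c, h]

end Rat

end Literature.NumberTheory.Automorphic.Meyer
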